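import Summits.Ventures.Crystal3D.Theorems.StickyWulffConstantCoaxialWallLawSeamMultiCoreSplit
import Summits.Ventures.Crystal3D.Theorems.StickyWulffConstantCoaxialWallLawCanonicalLensType
import Summits.Ventures.Crystal3D.Theorems.StickyWulffConstantCoaxialWallLawTerracePropagation
import Summits.Ventures.Crystal3D.Theorems.StickyWulffConstantCoaxialWallLawJammedMono
import HarnessLib

/-!
# READERS ARE EXACT: a straight-move (A)-pair is an (A)-pair of its READER's piece `coreOf Y q G` (crux `CoaxialWallLaw`, stmt-Ventures-19481; line `WallLedgerF`,
# skeleton 'CoaxialWallLawCertificates' v8.1, stub `stub_incoherentSeamSmall`; F-TAIL-g12 §7 step 2)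

HONEST FRAMING. Venture `Summits/Ventures/Crystal3D` (cell `crystal3d-full`); structural lemmas for the MULTI-PIECE proposal of lane F's T5b seam side (F-TAIL-g12 §7):
the piece of a reader `q` in its class frame `G` is the canonical core `coreOf Y q G` ANCHORED AT THE READER (placement `G`, window `B̄(q, 3)`), and the automaton's
straight moves read only SITE positions of that placement plus — for a twin/glide reading — mirror balls that CAP site triangles.  Nothing about the stubs is
claimed; whether the multi-piece split is adopted is cf-p1's decision; F-C1 not moved.
* `isEndMove_of_sites`, `isEndMove_straight_of_sites` — `…ModuleCaptureShallow.isEndMove_of_exact` with its blanket «every inspected ball in `E`» hypothesis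
  SPLIT by relevance: occupied dozen SITE positions of `q` and `b`, the reflected positions for an ACTUAL twin reading of `q`, and (cross moves only) the reflected
  positions of `b`; the straight version needs no cross hypothesis;
* `mem_coreOf_of_module` — the site clause (a window ball at a module position relative to the anchor is in the core), `mem_coreOf_of_slot`, `mem_coreOf_of_slot_add_slot`;
* `reflect_slot_mem_coreOf` — for a menu normal `n` of `G` whose in-plane hexagon around `q`
  is occupied, an occupied REFLECTED position `q + (G w − 2⟪G w, n⟫ n)` of an off-plane slot `w` CAPS the site triangle `{q, q + G(w − u'), q + G(w − u'')}` (`u', u''`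
  the far mates of `w`, from `…TerracePropagation.exists_far_frame`; differences of adjacent slots are slots, `…TwinFrame.sub_mem_fccSlots_of_inner_eq_half`), hence lies in `coreOf Y q G`; in-plane slots reflect to themselves (sites);
* **`isEndPairA_readerPiece_of_straight`** — a STRAIGHT-move (A)-end pair `(b, q)` of `Y` (`b = q + d`; reader FULL, NARROW or twin-GLIDING) is an (A)-end pair of
  the reader's piece `coreOf Y q G`.  (Cross moves read the target in the mirrored frame — the residual of §7(3), not here.)
-/

noncomputable section

namespace Summit.Ventures.Crystal3D.Theorems

namespace TailResidue

open Summit.Ventures.Crystal3D Finset NearIdentity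
open scoped InnerProductSpace

/-! ### `IsEndMove` descends under site hypotheses split by relevance -/

section Sites

variable {Y E : Finset (EuclideanSpace ℝ (Fin 3))} (hEY : E ⊆ Y)
  {G : EuclideanSpace ℝ (Fin 3) ≃ₗᵢ[ℝ] EuclideanSpace ℝ (Fin 3)} {q b d : EuclideanSpace ℝ (Fin 3)} {v : WordVersion}

include hEY in
/-- **`IsEndMove` descends to `E ⊆ Y`** when the occupied dozen SITE positions of `q` and `b` are in `E`, the occupied reflected positions of `q` for every ACTUAL
twin reading of `q` are in `E`, and — only used by cross moves — the occupied reflected positions of `b` for the reading normal are in `E`. -/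
theorem isEndMove_of_sites (h : IsEndMove Y v G d q b) (hbE : b ∈ E)
    (hsq : ∀ w ∈ fccSlots, q + G w ∈ Y → q + G w ∈ E) (hsb : ∀ w ∈ fccSlots, b + G w ∈ Y → b + G w ∈ E)
    (hmq : ∀ m, IsTwinReading Y G m q → ∀ w ∈ fccSlots, q + (G w - (2 * ⟪G w, m⟫_ℝ) • m) ∈ Y → q + (G w - (2 * ⟪G w, m⟫_ℝ) • m) ∈ E)
    (hmb : ∀ m, IsTwinReading Y G m q → ⟪d, m⟫_ℝ = Real.sqrt (2 / 3) →
      ∀ w ∈ fccSlots, b + (G w - (2 * ⟪G w, m⟫_ℝ) • m) ∈ Y → b + (G w - (2 * ⟪G w, m⟫_ℝ) • m) ∈ E) :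
    IsEndMove E v G d q b := by
  rcases h with ⟨hrd, hb, hnm⟩ | ⟨m, htw, hdm, hb, hnm⟩
  · refine Or.inl ⟨?_, hb, fun hmov => hnm (isMoving_of_subset hEY hsb hmov)⟩
    rcases hrd with hf | ⟨hv, hn⟩ | ⟨m, htw, hdm⟩
    · exact Or.inl (isFull_of_exact hf hsq)
    · exact Or.inr (Or.inl ⟨hv, isNarrow_of_exact hn hsq fun _ => by rw [← hb]; exact hbE⟩)
    · exact Or.inr (Or.inr ⟨m, isTwinReading_of_exact hEY htw hsq (hmq m htw), hdm⟩)
  · refine Or.inr ⟨m, isTwinReading_of_exact hEY htw hsq (hmq m htw), hdm, hb, fun hmov => hnm (isMoving_of_subset hEY ?_ hmov)⟩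
    intro w hw hmem
    have hm1 : ‖m‖ = 1 := htw.1.1
    have e : (G.trans (ℝ ∙ m)ᗮ.reflection) w = G w - (2 * ⟪G w, m⟫_ℝ) • m := by
      rw [LinearIsometryEquiv.trans_apply, reflection_unit_apply hm1]
    rw [e] at hmem ⊢
    exact hmb m htw hdm w hw hmem

include hEY in
/-- **Straight moves descend** under the site hypotheses of `q` and `b` and the reflected positions of actual twin readings of `q` (no cross hypothesis). -/
theorem isEndMove_straight_of_sites (hrd : IsFull Y G q ∨ (v = WordVersion.v2 ∧ IsNarrow Y G d q) ∨ ∃ m, IsTwinReading Y G m q ∧ ⟪d, m⟫_ℝ = 0)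
    (hb : b = q + d) (hnm : ¬ IsMoving Y v G d b) (hbE : b ∈ E)
    (hsq : ∀ w ∈ fccSlots, q + G w ∈ Y → q + G w ∈ E) (hsb : ∀ w ∈ fccSlots, b + G w ∈ Y → b + G w ∈ E)
    (hmq : ∀ m, IsTwinReading Y G m q → ∀ w ∈ fccSlots, q + (G w - (2 * ⟪G w, m⟫_ℝ) • m) ∈ Y → q + (G w - (2 * ⟪G w, m⟫_ℝ) • m) ∈ E) :
    IsEndMove E v G d q b := by
  refine Or.inl ⟨?_, hb, fun hmov => hnm (isMoving_of_subset hEY hsb hmov)⟩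
  rcases hrd with hf | ⟨hv, hn⟩ | ⟨m, htw, hdm⟩
  · exact Or.inl (isFull_of_exact hf hsq)
  · exact Or.inr (Or.inl ⟨hv, isNarrow_of_exact hn hsq fun _ => by rw [← hb]; exact hbE⟩)
  · exact Or.inr (Or.inr ⟨m, isTwinReading_of_exact hEY htw hsq (hmq m htw), hdm⟩)

end Sites

/-! ### The site clause of a piece anchored anywhere -/

/-- **Site clause**: a ball of `Y` within `3` of the anchor `c` at a MODULE position of the placement `S` (relative to `c`) is in `coreOf Y c S`. -/
theorem mem_coreOf_of_module {Y : Finset (EuclideanSpace ℝ (Fin 3))} {c : EuclideanSpace ℝ (Fin 3)} (S : EuclideanSpace ℝ (Fin 3) ≃ₗᵢ[ℝ] EuclideanSpace ℝ (Fin 3))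
    {x : EuclideanSpace ℝ (Fin 3)} (hx : x ∈ Y) (hcx : dist c x ≤ 3) (hmod : S.symm (x - c) ∈ coaxialModule 1 (Real.sqrt (2 / 3))) : x ∈ coreOf Y c S := by
  classical
  refine subset_capClosure _ (mem_filter.2 ⟨mem_filter.2 ⟨hx, hcx⟩, ?_⟩)
  obtain ⟨s, hs⟩ := mem_coaxialModule_iff.1 hmod
  have hsx : S.symm x + -S.symm c = modSite s := by rw [← hs, map_sub, sub_eq_add_neg]
  rw [hsx]
  refine ⟨s, mem_coe.2 (mem_siteBall_of_dsq12 ?_), rfl⟩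
  have hd : dist (modSite ((0, 0, 0) : ℤ × ℤ × ℤ)) (modSite s) ≤ 3 := by
    rw [modSite_zero, ← hs, dist_eq_norm, zero_sub, norm_neg, LinearIsometryEquiv.norm_map, ← dist_eq_norm, dist_comm]; exact hcx
  have hsq := dist_modSite_sq ((0, 0, 0) : ℤ × ℤ × ℤ) s
  have h9 : dist (modSite ((0, 0, 0) : ℤ × ℤ × ℤ)) (modSite s) ^ 2 ≤ 9 := by nlinarith [dist_nonneg (x := modSite ((0, 0, 0) : ℤ × ℤ × ℤ)) (y := modSite s)]
  have : (dsq12 (0, 0, 0) s : ℝ) ≤ 108 := by rw [hsq] at h9; linarith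
  exact_mod_cast this

/-- A dozen position `c + S w` (`w` a slot) carrying a ball of `Y` is in the piece anchored at `c`. -/
theorem mem_coreOf_of_slot {Y : Finset (EuclideanSpace ℝ (Fin 3))} {c : EuclideanSpace ℝ (Fin 3)} (S : EuclideanSpace ℝ (Fin 3) ≃ₗᵢ[ℝ] EuclideanSpace ℝ (Fin 3))
    {w : EuclideanSpace ℝ (Fin 3)} (hw : w ∈ fccSlots) (hx : c + S w ∈ Y) : c + S w ∈ coreOf Y c S := by
  refine mem_coreOf_of_module S hx ?_ ?_
  · rw [dist_slotSite_eq_one S c hw]; norm_num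
  · rw [add_sub_cancel_left, LinearIsometryEquiv.symm_apply_apply]; exact slot_mem_module hw

/-- A position `c + S u + S w` (`u, w` slots) carrying a ball of `Y` is in the piece anchored at `c`. -/
theorem mem_coreOf_of_slot_add_slot {Y : Finset (EuclideanSpace ℝ (Fin 3))} {c : EuclideanSpace ℝ (Fin 3)}
    (S : EuclideanSpace ℝ (Fin 3) ≃ₗᵢ[ℝ] EuclideanSpace ℝ (Fin 3)) {u w : EuclideanSpace ℝ (Fin 3)} (hu : u ∈ fccSlots) (hw : w ∈ fccSlots) (hx : c + S u + S w ∈ Y) :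
    c + S u + S w ∈ coreOf Y c S := by
  refine mem_coreOf_of_module S hx ?_ ?_
  · calc dist c (c + S u + S w) ≤ dist c (c + S u) + dist (c + S u) (c + S u + S w) := dist_triangle _ _ _
      _ = 1 + 1 := by rw [dist_slotSite_eq_one S c hu, dist_slotSite_eq_one S (c + S u) hw]
      _ ≤ 3 := by norm_num
  · rw [show c + S u + S w - c = S (u + w) by rw [map_add]; abel, LinearIsometryEquiv.symm_apply_apply]
    exact add_mem_module (slot_mem_module hu) (slot_mem_module hw)

/-! ### Reflected positions cap site triangles -/

/-- **A reflected far slot caps a site triangle**: for a unit menu normal `n` of `G` whose in-plane hexagon around `q ∈ Y` is occupied, an occupied reflected position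
`q + (G w − 2⟪G w, n⟫ n)` of a FAR slot `w` (`⟪G w, n⟫ > 0`) lies in `coreOf Y q G`. -/
theorem reflect_far_slot_mem_coreOf {Y : Finset (EuclideanSpace ℝ (Fin 3))} {G : EuclideanSpace ℝ (Fin 3) ≃ₗᵢ[ℝ] EuclideanSpace ℝ (Fin 3)} {n q : EuclideanSpace ℝ (Fin 3)}
    (hq : q ∈ Y) (hn1 : ‖n‖ = 1) (hmenu : ∀ u ∈ fccSlots, ⟪G u, n⟫_ℝ = 0 ∨ ⟪G u, n⟫_ℝ = Real.sqrt (2 / 3) ∨ ⟪G u, n⟫_ℝ = -Real.sqrt (2 / 3))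
    (hplane : ∀ u ∈ fccSlots, ⟪G u, n⟫_ℝ = 0 → q + G u ∈ Y) {w : EuclideanSpace ℝ (Fin 3)} (hw : w ∈ fccSlots) (hpos : 0 < ⟪G w, n⟫_ℝ)
    (hmem : q + (G w - (2 * ⟪G w, n⟫_ℝ) • n) ∈ Y) : q + (G w - (2 * ⟪G w, n⟫_ℝ) • n) ∈ coreOf Y q G := by
  classical
  obtain ⟨u₁, hu₁, u₂, hu₂, u₃, hu₃, hn₁, hn₂, hn₃, h12, h13, h23, -, huniq⟩ := exists_far_frame G hn1 hmenu
  -- the two far mates of `w`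
  obtain ⟨u', hu', u'', hu'', hn', hn'', hwu', hwu'', hu'u''⟩ : ∃ u' ∈ fccSlots, ∃ u'' ∈ fccSlots, ⟪G u', n⟫_ℝ = Real.sqrt (2 / 3) ∧
      ⟪G u'', n⟫_ℝ = Real.sqrt (2 / 3) ∧ ⟪w, u'⟫_ℝ = 1 / 2 ∧ ⟪w, u''⟫_ℝ = 1 / 2 ∧ ⟪u', u''⟫_ℝ = 1 / 2 := by
    rcases huniq w hw hpos with rfl | rfl | rfl
    · exact ⟨u₂, hu₂, u₃, hu₃, hn₂, hn₃, h12, h13, h23⟩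
    · exact ⟨u₁, hu₁, u₃, hu₃, hn₁, hn₃, by rw [real_inner_comm]; exact h12, h23, h13⟩
    · exact ⟨u₁, hu₁, u₂, hu₂, hn₁, hn₂, by rw [real_inner_comm]; exact h13, by rw [real_inner_comm]; exact h23, h12⟩
  have hwn : ⟪G w, n⟫_ℝ = Real.sqrt (2 / 3) := by
    rcases huniq w hw hpos with rfl | rfl | rfl
    · exact hn₁
    · exact hn₂
    · exact hn₃
  -- the in-plane neighbours `w − u'`, `w − u''`
  have hh' : w - u' ∈ fccSlots := sub_mem_fccSlots_of_inner_eq_half hw hu' hwu'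
  have hh'' : w - u'' ∈ fccSlots := sub_mem_fccSlots_of_inner_eq_half hw hu'' hwu''
  have hh'n : ⟪G (w - u'), n⟫_ℝ = 0 := by rw [map_sub, inner_sub_left, hwn, hn']; ring
  have hh''n : ⟪G (w - u''), n⟫_ℝ = 0 := by rw [map_sub, inner_sub_left, hwn, hn'']; ring
  have hE' : q + G (w - u') ∈ coreOf Y q G := mem_coreOf_of_slot G hh' (hplane _ hh' hh'n)
  have hE'' : q + G (w - u'') ∈ coreOf Y q G := mem_coreOf_of_slot G hh'' (hplane _ hh'' hh''n)
  -- the reflected point and its distances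
  set R := (ℝ ∙ n)ᗮ.reflection with hR
  have hx : G w - (2 * ⟪G w, n⟫_ℝ) • n = R (G w) := (reflection_unit_apply hn1 (G w)).symm
  have hRfix : ∀ {p : EuclideanSpace ℝ (Fin 3)}, ⟪G p, n⟫_ℝ = 0 → R (G p) = G p := fun hp =>
    Submodule.reflection_mem_subspace_eq_self (Submodule.mem_orthogonal_singleton_iff_inner_left.2 hp)
  have nw : ‖G w‖ = 1 := by rw [LinearIsometryEquiv.norm_map]; exact norm_eq_one_of_mem_fccSlots hw
  have d0 : dist (q + R (G w)) q = 1 := by rw [dist_eq_norm, add_sub_cancel_left, LinearIsometryEquiv.norm_map, nw]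
  have dside : ∀ {u : EuclideanSpace ℝ (Fin 3)}, u ∈ fccSlots → ⟪G (w - u), n⟫_ℝ = 0 → dist (q + R (G w)) (q + G (w - u)) = 1 := by
    intro u hu hun
    rw [dist_eq_norm, add_sub_add_left_eq_sub, ← hRfix hun, ← map_sub, LinearIsometryEquiv.norm_map, ← map_sub, LinearIsometryEquiv.norm_map,
      sub_sub_cancel]
    exact norm_eq_one_of_mem_fccSlots hu
  have d12 : dist (q + G (w - u')) (q + G (w - u'')) = 1 := by
    rw [dist_eq_norm, add_sub_add_left_eq_sub, ← map_sub, LinearIsometryEquiv.norm_map, show w - u' - (w - u'') = u'' - u' by abel]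
    exact norm_sub_eq_one_of_inner_half (norm_eq_one_of_mem_fccSlots hu'') (norm_eq_one_of_mem_fccSlots hu') (by rw [real_inner_comm]; exact hu'u'')
  have hcap : CapsTriangleIn (coreOf Y q G) (q + R (G w)) :=
    ⟨q, mem_coreOf_self hq G, _, hE', _, hE'', dist_slotSite_eq_one G q hh', dist_slotSite_eq_one G q hh'', d12, d0, dside hu' hh'n, dside hu'' hh''n⟩
  rw [hx] at hmem ⊢
  exact mem_capClosure_of_capsTriangleIn (siteBallsAt_subset _ _ _) (mem_filter.2 ⟨hmem, by rw [dist_comm, d0]; norm_num⟩) hcap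

/-- **Reflected positions of a menu normal lie in the reader's piece** (any slot: in-plane slots reflect to themselves and are sites; far/near slots by
`reflect_far_slot_mem_coreOf` for `n` resp. `−n`). -/
theorem reflect_slot_mem_coreOf {Y : Finset (EuclideanSpace ℝ (Fin 3))} {G : EuclideanSpace ℝ (Fin 3) ≃ₗᵢ[ℝ] EuclideanSpace ℝ (Fin 3)} {n q : EuclideanSpace ℝ (Fin 3)}
    (hq : q ∈ Y) (hn : IsMenuNormal G n) (hplane : ∀ u ∈ fccSlots, ⟪G u, n⟫_ℝ = 0 → q + G u ∈ Y) {w : EuclideanSpace ℝ (Fin 3)} (hw : w ∈ fccSlots)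
    (hmem : q + (G w - (2 * ⟪G w, n⟫_ℝ) • n) ∈ Y) : q + (G w - (2 * ⟪G w, n⟫_ℝ) • n) ∈ coreOf Y q G := by
  obtain ⟨hn1, hmenu⟩ := hn
  rcases lt_trichotomy 0 ⟪G w, n⟫_ℝ with hpos | hzero | hneg
  · exact reflect_far_slot_mem_coreOf hq hn1 hmenu hplane hw hpos hmem
  · have e : G w - (2 * ⟪G w, n⟫_ℝ) • n = G w := by rw [← hzero]; simp
    rw [e] at hmem ⊢
    exact mem_coreOf_of_slot G hw hmem
  · -- use the normal `−n`
    have hmenu' : ∀ u ∈ fccSlots, ⟪G u, -n⟫_ℝ = 0 ∨ ⟪G u, -n⟫_ℝ = Real.sqrt (2 / 3) ∨ ⟪G u, -n⟫_ℝ = -Real.sqrt (2 / 3) := by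
      intro u hu
      rcases hmenu u hu with h | h | h
      · exact Or.inl (by rw [inner_neg_right, h, neg_zero])
      · exact Or.inr (Or.inr (by rw [inner_neg_right, h]))
      · exact Or.inr (Or.inl (by rw [inner_neg_right, h, neg_neg]))
    have hplane' : ∀ u ∈ fccSlots, ⟪G u, -n⟫_ℝ = 0 → q + G u ∈ Y := fun u hu h => hplane u hu (by rw [inner_neg_right] at h; linarith)
    have e : G w - (2 * ⟪G w, n⟫_ℝ) • n = G w - (2 * ⟪G w, -n⟫_ℝ) • (-n) := by rw [inner_neg_right]; simp [smul_neg, neg_smul]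
    rw [e] at hmem ⊢
    exact reflect_far_slot_mem_coreOf hq (by rw [norm_neg, hn1]) hmenu' hplane' hw (by rw [inner_neg_right]; linarith) hmem

/-! ### Straight-move pairs are pairs of the reader's piece -/

/-- **A STRAIGHT-MOVE (A)-END PAIR IS AN (A)-END PAIR OF ITS READER'S PIECE.**  Data of the pair: admissible class `(G, d)`, predecessor `q − d ∈ Y`, a straight
reading of `q` (FULL, NARROW under `v2`, or twin reading gliding along `d`), target `b = q + d` not moving, two payers at `b`.  Conclusion: the same pair is an
(A)-end pair of `coreOf Y q G` — the reader, the target, the predecessor and every ball the reading uses are sites of the reader's placement or cap site triangles. -/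
theorem isEndPairA_readerPiece_of_straight {Y : Finset (EuclideanSpace ℝ (Fin 3))} (hY : ∀ p ∈ Y, ∀ p' ∈ Y, p ≠ p' → 1 ≤ dist p p')
    {v : WordVersion} {S₁ S₂ : PlateSystem} (h₁ : S₁.RT ⊆ fccSlots) (h₂ : S₂.RT ⊆ fccSlots)
    {G : EuclideanSpace ℝ (Fin 3) ≃ₗᵢ[ℝ] EuclideanSpace ℝ (Fin 3)} {q b d : EuclideanSpace ℝ (Fin 3)} (hq : q ∈ Y) (hb : b ∈ Y) (hpay : HasTwoPayers Y b)
    (hadm : S₁.Adm G d ∨ S₂.Adm G d) (hqd : q - d ∈ Y)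
    (hrd : IsFull Y G q ∨ (v = WordVersion.v2 ∧ IsNarrow Y G d q) ∨ ∃ m, IsTwinReading Y G m q ∧ ⟪d, m⟫_ℝ = 0) (hbq : b = q + d) (hnm : ¬ IsMoving Y v G d b) :
    IsEndPairA (coreOf Y q G) v S₁ S₂ b q := by
  classical
  set E := coreOf Y q G with hE
  have hEY : E ⊆ Y := coreOf_subset Y q G
  -- `d` and `−d` are frame slots
  obtain ⟨⟨u, hu, hdu⟩, ⟨u', hu', hdu'⟩⟩ : (∃ u ∈ fccSlots, d = G u) ∧ (∃ u ∈ fccSlots, -d = G u) := by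
    rcases hadm with h | h
    · exact exists_slots_of_adm h₁ h
    · exact exists_slots_of_adm h₂ h
  have hqE : q ∈ E := mem_coreOf_self hq G
  have hbE : b ∈ E := by rw [hbq, hdu] at hb ⊢; exact mem_coreOf_of_slot G hu hb
  have hqdE : q - d ∈ E := by rw [sub_eq_add_neg, hdu'] at hqd ⊢; exact mem_coreOf_of_slot G hu' hqd
  -- site hypotheses
  have hsq : ∀ w ∈ fccSlots, q + G w ∈ Y → q + G w ∈ E := fun w hw hmem => mem_coreOf_of_slot G hw hmem
  have hsb : ∀ w ∈ fccSlots, b + G w ∈ Y → b + G w ∈ E := by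
    intro w hw hmem
    rw [hbq, hdu] at hmem ⊢
    exact mem_coreOf_of_slot_add_slot G hu hw hmem
  have hmq : ∀ m, IsTwinReading Y G m q → ∀ w ∈ fccSlots, q + (G w - (2 * ⟪G w, m⟫_ℝ) • m) ∈ Y → q + (G w - (2 * ⟪G w, m⟫_ℝ) • m) ∈ E :=
    fun m htw w hw hmem => reflect_slot_mem_coreOf hq htw.1 (fun u hu h0 => htw.2.1 u hu h0.le) hw hmem
  refine ⟨hqE, hbE, ?_, G, d, hadm, hqdE, isEndMove_straight_of_sites hEY hrd hbq hnm hbE hsq hsb hmq⟩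
  -- two payers in `E`
  have hdeg : ∀ y, (E.filter fun p => dist y p = 1).card ≤ (Y.filter fun p => dist y p = 1).card :=
    fun y => card_le_card (fun p hp => by rw [mem_filter] at hp ⊢; exact ⟨hEY hp.1, hp.2⟩)
  rcases hpay with hle | ⟨z₁, hz₁, z₂, hz₂, hne, hd₁, hd₂, hdeg₁, hdeg₂⟩
  · exact Or.inl ((hdeg b).trans hle)
  · have drop : ∀ {w}, w ∈ Y → w ∉ E → dist b w = 1 → (E.filter fun p => dist b p = 1).card ≤ 11 := by
      intro w hw hwE hd
      have hwmem : w ∈ Y.filter fun p => dist b p = 1 := mem_filter.2 ⟨hw, hd⟩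
      have hs : E.filter (fun p => dist b p = 1) ⊆ (Y.filter fun p => dist b p = 1).erase w := by
        intro p hp; rw [mem_filter] at hp
        exact mem_erase.2 ⟨fun h => hwE (h ▸ hp.1), mem_filter.2 ⟨hEY hp.1, hp.2⟩⟩
      have h12 := card_filter_dist_eq_one_le_twelve Y hY b
      have hc := card_le_card hs
      rw [card_erase_of_mem hwmem] at hc
      omega
    by_cases hE₁ : z₁ ∈ E
    · by_cases hE₂ : z₂ ∈ E
      · exact Or.inr ⟨z₁, hE₁, z₂, hE₂, hne, hd₁, hd₂, (hdeg z₁).trans hdeg₁, (hdeg z₂).trans hdeg₂⟩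
      · exact Or.inl (drop hz₂ hE₂ hd₂)
    · exact Or.inl (drop hz₁ hE₁ hd₁)

end TailResidue

end Summit.Ventures.Crystal3D.Theorems

end
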